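import Literature.NumberTheory.Automorphic.ConstantTermBlockGL
import Literature.NumberTheory.Automorphic.HarishChandraFinitenessGLIdealOfCharacter
import Literature.NumberTheory.Automorphic.AdelicSecondCountable
import HarnessLib

/-!
# The constant term along a maximal parabolic commutes with `U(𝔤)`; `K_∞`-types and
# `Z(𝔤)`-characters of constant terms (Moeglin–Waldspurger 1995, I.2.6; Borel–Jacquet 1979, 4.4)

Topic `NumberTheory/Automorphic`; a sequel of `ConstantTermBlockGL` (the constant term
`φ_P = blockCT (le_refl n) k ν φ` of a function on `GL_n(𝔸_K)` along the standard maximal parabolic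
`P_k`, as a FUNCTION on `GL_n(𝔸_K)`: level, linearity, left `N_k(𝔸_K)`-invariance, growth) and of
`CuspConditionGLLieDeriv` (differentiation under the integral over the compact quotient
`N_k(K)\N_k(𝔸_K)`). It supplies the next items of Moeglin–Waldspurger's list I.2.6 of elementary
properties of constant terms — the ones through which the `Z(𝔤)`-finiteness and the
`K_∞`-finiteness of `φ` pass to `φ_P` in Harish-Chandra's finiteness theorem (Borel–Jacquet 1979,
4.3 (i); the tree's named fact `harishChandra_finiteness_gl` of `AutomorphicRepsGL`) — for `φ` left
`GL_n(K)`-invariant, smooth in the archimedean variable and right invariant under an admissible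
level:

* `IsLeftInvariant.lieDeriv_blockCT` — **right Lie derivatives commute with the constant term**,
  `X (φ_P) = (X φ)_P` for `X ∈ 𝔤𝔩_n(K_∞)`: `s ↦ φ_P (y (exp sX, 1)) = ∫_D φ ((1 + N) y (exp sX, 1)) dν(N)`
  is differentiated under the integral sign at `s = 0` (Mathlib's
  `hasDerivAt_integral_of_dominated_loc_of_deriv_le`; the `s`-derivative `(X φ)((1 + N) y (exp sX, 1))`
  is bounded uniformly in `N` and `|s| ≤ 1` by periodicity,
  `IsLeftInvariant.exists_forall_norm_apply_glUnipotent_mul_le`, and Tate's box `D` has finite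
  measure) — the interchange "if `φ` is smooth then `φ_P` is smooth, and `(X φ)_P = X φ_P`" of
  Moeglin–Waldspurger I.2.6;
* `IsLeftInvariant.iterLieDeriv_blockCT`, `IsLeftInvariant.applyFree_blockCT` — hence
  `(p φ)_P = p (φ_P)` for every word and every `p ∈ ℝ⟨𝔤⟩`;
* `HasZCharacter.blockCT` — **`φ_P` has the `Z(𝔤)`-character of `φ`**;
* `Submodule.integral_mem_of_forall_mem` — a Bochner integral of functions lying in a
  finite-dimensional space `W` of functions lies in `W` (every coordinate functional of `W` is a
  finite combination of evaluations, `exists_finsupp_eval_eq`), and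
  `IsLeftInvariant.blockCT_slice_mem` — **the `K_∞`-slices `κ ↦ φ_P (y κ)` of the constant term lie
  in any finite-dimensional space `M` containing the slices of `φ`** (the `K_∞`-types of `φ_P` are
  among those of `φ`; Borel–Jacquet 1979, 4.4: "`φ_P` is `K`-finite on the right");
* `continuous_blockCT` — `φ_P` is continuous for `φ` continuous (domination on compact
  neighbourhoods; `GL_n(𝔸_K)` is locally compact).

Everything here is proved: theorems only, no definition, no named fact.

## References

* C. Moeglin, J.-L. Waldspurger, *Spectral decomposition and Eisenstein series*, Cambridge Tracts
  in Math. 113 (1995), I.2.6 [MoeglinWaldspurger1995].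
* A. Borel, H. Jacquet, *Automorphic forms and automorphic representations*, Proc. Sympos. Pure
  Math. 33 (Corvallis 1977), Part 1 (1979), 4.3–4.4 [BorelJacquet1979].
-/

noncomputable section

open scoped MatrixGroups Matrix ContDiff Classical Topology
open NumberField NumberField.mixedEmbedding IsDedekindDomain Filter Set
open _root_.MeasureTheory

namespace Literature.NumberTheory.Automorphic

/-! ### 0. Integrals with values in a finite-dimensional space of functions -/

section FiniteDimensional

/-- **A Bochner integral of functions lying in a finite-dimensional space `W` of functions lies in
`W`.** If `f a ∈ W` for every `a` and every coordinate `a ↦ f a x` is integrable, then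
`x ↦ ∫ f a x dμ(a)` belongs to `W`: in a basis `(b_j)` of `W` the coordinate functionals are finite
linear combinations of evaluations (`exists_finsupp_eval_eq`), so the coordinates of `f a` are
integrable combinations of the `f a x'` and `∫ f a dμ = ∑_j (∫ coord_j (f a) dμ) b_j`. [folklore] -/
theorem Submodule.integral_mem_of_forall_mem {X A : Type*} [MeasurableSpace A] (μ : Measure A)
    (W : Submodule ℂ (X → ℂ)) [FiniteDimensional ℂ W] {f : A → X → ℂ} (hf : ∀ a, f a ∈ W)
    (hint : ∀ x, Integrable (fun a => f a x) μ) :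
    (fun x => ∫ a, f a x ∂μ) ∈ W := by
  set b := Module.finBasis ℂ W with hb
  -- coordinate functionals as finite combinations of evaluations
  choose c hc using fun j => exists_finsupp_eval_eq W (b.coord j)
  -- expansion of an element of `W` in the basis, as functions
  have hexpW : ∀ w : W, (w : X → ℂ) = ∑ j, (b.coord j w) • (b j : X → ℂ) := by
    intro w
    conv_lhs => rw [← b.sum_repr w]
    simp only [Submodule.coe_sum, Submodule.coe_smul, Module.Basis.coord_apply]
  have hexp : ∀ a x, f a x = ∑ j, ((c j).sum fun x' r => r * f a x') * (b j : X → ℂ) x := by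
    intro a x
    have h := congrFun (hexpW ⟨f a, hf a⟩) x
    rw [Finset.sum_apply] at h
    refine h.trans (Finset.sum_congr rfl fun j _ => ?_)
    rw [Pi.smul_apply, smul_eq_mul, hc j ⟨f a, hf a⟩]
  -- integrability of the coordinates
  have hint' : ∀ j, Integrable (fun a => (c j).sum fun x' r => r * f a x') μ := by
    intro j
    simp only [Finsupp.sum]
    exact integrable_finsetSum _ fun x' _ => (hint x').const_mul _
  -- compute the integral
  have hcalc : (fun x => ∫ a, f a x ∂μ) =
      ∑ j, (∫ a, (c j).sum (fun x' r => r * f a x') ∂μ) • (b j : X → ℂ) := by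
    funext x
    rw [Finset.sum_apply]
    simp only [Pi.smul_apply, smul_eq_mul]
    rw [show (fun a => f a x) = fun a => ∑ j, ((c j).sum fun x' r => r * f a x') * (b j : X → ℂ) x
      from funext fun a => hexp a x]
    rw [integral_finsetSum _ fun j _ => (hint' j).mul_const _]
    refine Finset.sum_congr rfl fun j _ => ?_
    exact integral_mul_const _ _
  rw [hcalc]
  exact W.sum_mem fun j _ => W.smul_mem _ (b j).2

end FiniteDimensional

variable {K : Type} [Field K] [NumberField K]
  [MeasurableSpace (AdeleRing (𝓞 K) K)] [BorelSpace (AdeleRing (𝓞 K) K)] {n : ℕ}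

/-! ### 1. Right Lie derivatives commute with the constant term -/

section LieDeriv

variable {k : ℕ}

/-- **Right Lie derivatives commute with the constant term** (Moeglin–Waldspurger I.2.6: "if `φ`
is smooth then `φ_P` is smooth", with `(X φ)_P = X (φ_P)`). Let `φ : GL_n(𝔸_K) → ℂ` be left
`GL_n(K)`-invariant, smooth in the archimedean variable and right invariant under an admissible
level, `ν` a measure finite on compact sets on the box coordinates of `𝔫_k(𝔸_K)`. Then for every
`X ∈ 𝔤𝔩_n(K_∞)` and `y`, `(X φ_P)(y) = (X φ)_P (y)`: the function
`s ↦ φ_P (y (exp sX, 1)) = ∫_D φ ((1 + N) y (exp sX, 1)) dν(N)` is differentiable at `0` under the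
integral sign with derivative `∫_D (X φ)((1 + N) y) dν(N)` — the integrand's `s`-derivative
`(X φ)((1 + N) y (exp sX, 1))` (`IsArchSmooth.hasDerivAt_expMem_smul`) is continuous and bounded
uniformly in `N` and `|s| ≤ 1` (`IsLeftInvariant.exists_forall_norm_apply_glUnipotent_mul_le`), and
Tate's box has finite measure. [cite: MoeglinWaldspurger1995, I.2.6] -/
theorem IsLeftInvariant.lieDeriv_blockCT {φ : GL (Fin n) (AdeleRing (𝓞 K) K) → ℂ}
    (hleft : IsLeftInvariant (AdelicGroupData.gl n K) φ) (hs : IsArchSmooth (glArch n K) φ)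
    {U : Subgroup (GL (Fin n) (AdeleRing (𝓞 K) K))} (hU : U ∈ finiteLevelsGL n K)
    (hφU : IsRightInvariantUnder U φ) (ν : Measure (BlockIdx n k → AdeleRing (𝓞 K) K))
    [IsFiniteMeasureOnCompacts ν] (X₀ : (archGroupGL n K).lie) (y : GL (Fin n) (AdeleRing (𝓞 K) K)) :
    lieDeriv (glArch n K) X₀ (blockCT (le_refl n) k ν φ) y =
      blockCT (le_refl n) k ν (lieDeriv (glArch n K) X₀ φ) y := by
  haveI := t2Space_adeleRing K
  haveI := secondCountableTopology_adeleRing K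
  haveI : BorelSpace (BlockIdx n k → AdeleRing (𝓞 K) K) := Pi.borelSpace
  -- the derivative and its regularity
  set ψ : GL (Fin n) (AdeleRing (𝓞 K) K) → ℂ := lieDeriv (glArch n K) X₀ φ with hψ
  have hφc : Continuous φ := continuous_of_isArchSmooth_of_isRightInvariantUnder hs hU hφU
  have hψc : Continuous ψ :=
    continuous_of_isArchSmooth_of_isRightInvariantUnder (hs.lieDeriv_gl X₀) hU (hφU.lieDeriv_gl hU X₀)
  have hψleft : IsLeftInvariant (AdelicGroupData.gl n K) ψ :=
    IsLeftInvariantUnder.lieDeriv_gl (V := (AdelicGroupData.gl n K).arithmeticSubgroup) hleft X₀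
  -- the one-parameter subgroup
  set e : ℝ → GL (Fin n) (AdeleRing (𝓞 K) K) := fun s =>
    glArch n K ((archGroupGL n K).expMem (s • X₀)) with he
  have he0 : e 0 = 1 := by
    simp only [he, RealMatrixGroup.expMem_zero_smul, map_one]
  -- the unipotents in box coordinates
  set u : (BlockIdx n k → AdeleRing (𝓞 K) K) → GL (Fin n) (AdeleRing (𝓞 K) K) := fun N =>
    unipotentOfBlock n k (AdeleRing (𝓞 K) K)
      (Multiplicative.ofAdd (blockMatrixEquiv (AdeleRing (𝓞 K) K) n k N)) with hu
  have huc : Continuous u :=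
    continuous_unipotentOfBlock_ofAdd'.comp (continuous_blockMatrixEquiv n k)
  -- the parametric integrand and its derivative
  set F : ℝ → (BlockIdx n k → AdeleRing (𝓞 K) K) → ℂ := fun s N => φ (u N * y * e s) with hF
  set F' : ℝ → (BlockIdx n k → AdeleRing (𝓞 K) K) → ℂ := fun s N => ψ (u N * y * e s) with hF'
  have hFc : ∀ s, Continuous (F s) := fun s =>
    hφc.comp ((huc.mul continuous_const).mul continuous_const)
  have hF'c : ∀ s, Continuous (F' s) := fun s =>
    hψc.comp ((huc.mul continuous_const).mul continuous_const)
  -- finiteness of the measure of the box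
  have hfin : ν (piFundamentalDomain K (BlockIdx n k)) < ⊤ :=
    (measure_mono subset_closure).trans_lt
      (isCompact_closure_piFundamentalDomain K (BlockIdx n k)).measure_lt_top
  haveI : IsFiniteMeasure (ν.restrict (piFundamentalDomain K (BlockIdx n k))) :=
    ⟨by rwa [Measure.restrict_apply_univ]⟩
  -- a uniform bound for the derivative
  obtain ⟨M, hM⟩ := hψleft.exists_forall_norm_apply_glUnipotent_mul_le (k := k) hψc y X₀
  have hbound : ∀ (N : BlockIdx n k → AdeleRing (𝓞 K) K), ∀ s ∈ Icc (-1 : ℝ) 1,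
      ‖F' s N‖ ≤ M := fun N s hs => hM _ s hs
  -- differentiability of the integrand in the parameter
  have hdiff : ∀ (N : BlockIdx n k → AdeleRing (𝓞 K) K) (s : ℝ),
      HasDerivAt (fun s => F s N) (F' s N) s := fun N s =>
    hs.hasDerivAt_expMem_smul (glArch n K) X₀ (u N * y) s
  -- integrability at `s = 0`
  have hint0 : Integrable (F 0) (ν.restrict (piFundamentalDomain K (BlockIdx n k))) := by
    have h := hleft.integrableOn_blockCT (k := k) hφc ν (y * e 0)
    simp_rw [glCorner_refl, ← mul_assoc] at h
    exact h
  -- differentiate under the integral sign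
  have key := hasDerivAt_integral_of_dominated_loc_of_deriv_le
    (μ := ν.restrict (piFundamentalDomain K (BlockIdx n k))) (x₀ := (0 : ℝ))
    (F := F) (F' := F') (s := Icc (-1 : ℝ) 1) (bound := fun _ => M)
    (Icc_mem_nhds (by norm_num) (by norm_num))
    (Eventually.of_forall fun s => (hFc s).aestronglyMeasurable)
    hint0
    (hF'c 0).aestronglyMeasurable
    (Eventually.of_forall fun N s hs => hbound N s hs)
    (integrable_const M)
    (Eventually.of_forall fun N s _ => hdiff N s)
  obtain ⟨-, hderiv⟩ := key
  -- identify the two sides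
  have hL : (fun t : ℝ => blockCT (le_refl n) k ν φ (y * glArch n K ((archGroupGL n K).expMem (t • X₀)))) =
      fun t => ∫ N in piFundamentalDomain K (BlockIdx n k), F t N ∂ν := by
    funext t
    rw [blockCT_apply]
    simp_rw [glCorner_refl, ← mul_assoc]
    rfl
  change deriv (fun t : ℝ => blockCT (le_refl n) k ν φ
    (y * glArch n K ((archGroupGL n K).expMem (t • X₀)))) 0 = _
  rw [hL, hderiv.deriv, blockCT_apply]
  simp_rw [glCorner_refl]
  simp only [hF', hψ, hu, he0, mul_one]

/-- **Iterated right Lie derivatives commute with the constant term**: `(X₁ ⋯ X_m φ)_P =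
X₁ ⋯ X_m (φ_P)` (`IsLeftInvariant.lieDeriv_blockCT` iterated; the hypotheses are stable under Lie
derivatives: `IsLeftInvariantUnder.iterLieDeriv_gl`, `IsArchSmooth.iterLieDeriv_gl`,
`IsRightInvariantUnder.iterLieDeriv_gl`). [cite: MoeglinWaldspurger1995, I.2.6] -/
theorem IsLeftInvariant.iterLieDeriv_blockCT {φ : GL (Fin n) (AdeleRing (𝓞 K) K) → ℂ}
    (hleft : IsLeftInvariant (AdelicGroupData.gl n K) φ) (hs : IsArchSmooth (glArch n K) φ)
    {U : Subgroup (GL (Fin n) (AdeleRing (𝓞 K) K))} (hU : U ∈ finiteLevelsGL n K)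
    (hφU : IsRightInvariantUnder U φ) (ν : Measure (BlockIdx n k → AdeleRing (𝓞 K) K))
    [IsFiniteMeasureOnCompacts ν] (w : List (archGroupGL n K).lie) :
    iterLieDeriv (glArch n K) w (blockCT (le_refl n) k ν φ) =
      blockCT (le_refl n) k ν (iterLieDeriv (glArch n K) w φ) := by
  induction w with
  | nil => rfl
  | cons X w ih =>
    rw [iterLieDeriv_cons, iterLieDeriv_cons, ih]
    funext y
    exact IsLeftInvariant.lieDeriv_blockCT
      (IsLeftInvariantUnder.iterLieDeriv_gl (V := (AdelicGroupData.gl n K).arithmeticSubgroup) hleft w)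
      (hs.iterLieDeriv_gl w) hU (hφU.iterLieDeriv_gl hU w) ν X y

/-- **The word action commutes with the constant term**: `(p φ)_P = p (φ_P)` for every
non-commutative polynomial `p ∈ ℝ⟨𝔤⟩` (a finite linear combination of iterated Lie derivatives;
linearity of the constant term on integrable integrands). [cite: MoeglinWaldspurger1995, I.2.6] -/
theorem IsLeftInvariant.applyFree_blockCT {φ : GL (Fin n) (AdeleRing (𝓞 K) K) → ℂ}
    (hleft : IsLeftInvariant (AdelicGroupData.gl n K) φ) (hs : IsArchSmooth (glArch n K) φ)
    {U : Subgroup (GL (Fin n) (AdeleRing (𝓞 K) K))} (hU : U ∈ finiteLevelsGL n K)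
    (hφU : IsRightInvariantUnder U φ) (ν : Measure (BlockIdx n k → AdeleRing (𝓞 K) K))
    [IsFiniteMeasureOnCompacts ν] (p : FreeAlgebra ℝ (archGroupGL n K).lie) :
    applyFree (glArch n K) p (blockCT (le_refl n) k ν φ) =
      blockCT (le_refl n) k ν (applyFree (glArch n K) p φ) := by
  haveI := t2Space_adeleRing K
  haveI := secondCountableTopology_adeleRing K
  haveI : BorelSpace (BlockIdx n k → AdeleRing (𝓞 K) K) := Pi.borelSpace
  rw [applyFree_eq_finset_sum, applyFree_eq_finset_sum]
  funext y
  -- each summand is integrable on the box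
  have hint : ∀ (w : FreeMonoid (archGroupGL n K).lie) (a : ℂ),
      Integrable (fun N : BlockIdx n k → AdeleRing (𝓞 K) K =>
        a • iterLieDeriv (glArch n K) (FreeMonoid.toList w) φ
          (unipotentOfBlock n k (AdeleRing (𝓞 K) K)
            (Multiplicative.ofAdd (blockMatrixEquiv (AdeleRing (𝓞 K) K) n k N)) * y))
        (ν.restrict (piFundamentalDomain K (BlockIdx n k))) := by
    intro w a
    have hwl : IsLeftInvariant (AdelicGroupData.gl n K)
        (iterLieDeriv (glArch n K) (FreeMonoid.toList w) φ) :=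
      IsLeftInvariantUnder.iterLieDeriv_gl (V := (AdelicGroupData.gl n K).arithmeticSubgroup) hleft _
    have hwc : Continuous (iterLieDeriv (glArch n K) (FreeMonoid.toList w) φ) :=
      continuous_of_isArchSmooth_of_isRightInvariantUnder (hs.iterLieDeriv_gl _) hU
        (hφU.iterLieDeriv_gl hU _)
    have h := hwl.integrableOn_blockCT (k := k) hwc ν y
    simp_rw [glCorner_refl] at h
    exact h.smul a
  simp only [Finset.sum_apply, Pi.smul_apply, hleft.iterLieDeriv_blockCT hs hU hφU ν]
  rw [blockCT_apply]
  simp_rw [glCorner_refl, Finset.sum_apply, Pi.smul_apply]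
  refine Eq.trans ?_ (integral_finsetSum _ fun w _ => hint w _).symm
  refine Finset.sum_congr rfl fun w _ => ?_
  rw [integral_smul, blockCT_apply]
  simp_rw [glCorner_refl]

/-- **The constant term has the `Z(𝔤)`-character of the form**: if every central word `z` acts on
`φ` by `θ(z)`, then it acts on `φ_P` by `θ(z)` (`(z φ)_P = z (φ_P)` and linearity). In particular
`φ_P` is annihilated by the ideal `ker θ` of `Z(𝔤)` with `φ` — the `Z(𝔤)`-finiteness clause of
Moeglin–Waldspurger I.2.6 / Borel–Jacquet 4.4 in the form used by Harish-Chandra's finiteness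
theorem. [cite: MoeglinWaldspurger1995, I.2.6] -/
theorem HasZCharacter.blockCT {φ : GL (Fin n) (AdeleRing (𝓞 K) K) → ℂ}
    {θ : centerU (archGroupGL n K) →ₐ[ℝ] ℂ} (hθ : HasZCharacter (glArch n K) φ θ)
    (hleft : IsLeftInvariant (AdelicGroupData.gl n K) φ) (hs : IsArchSmooth (glArch n K) φ)
    {U : Subgroup (GL (Fin n) (AdeleRing (𝓞 K) K))} (hU : U ∈ finiteLevelsGL n K)
    (hφU : IsRightInvariantUnder U φ) (ν : Measure (BlockIdx n k → AdeleRing (𝓞 K) K))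
    [IsFiniteMeasureOnCompacts ν] :
    HasZCharacter (glArch n K) (blockCT (le_refl n) k ν φ) θ := by
  intro p hp
  rw [hleft.applyFree_blockCT hs hU hφU ν p, hθ p hp]
  funext y
  exact blockCT_smul _ _ _ _ _ _

end LieDeriv

/-! ### 2. `K_∞`-slices of the constant term -/

section Slices

variable {k : ℕ}

/-- **The `K_∞`-slices of the constant term lie in any finite-dimensional space containing the
slices of the form**: if `κ ↦ φ (g κ)` lies in `M` for every `g` (`M ≤ (K_∞ → ℂ)` finite
dimensional), then so does `κ ↦ φ_P (y κ) = ∫_D φ ((1 + N) y κ) dν(N)` — an integral of elements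
of `M` (`Submodule.integral_mem_of_forall_mem`; the coordinates `N ↦ φ ((1 + N) y κ)` are
integrable on the box for `φ` continuous and left `GL_n(K)`-invariant). This is "`φ_P` is
`K`-finite on the right, with the `K`-types of `φ`" (Borel–Jacquet 1979, 4.4; Moeglin–Waldspurger
I.2.6). [cite: BorelJacquet1979, 4.4] -/
theorem IsLeftInvariant.blockCT_slice_mem {hcpt : isCompact_glFiniteIntegralLevel n K}
    (M : Submodule ℂ (Kinf n K → ℂ)) [FiniteDimensional ℂ M]
    {φ : (AdelicGroupData.gl n K).Adelic → ℂ} (hφc : Continuous φ)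
    (hleft : IsLeftInvariant (AdelicGroupData.gl n K) φ)
    (hφM : ∀ g : (AdelicGroupData.gl n K).Adelic,
      (fun κ : Kinf n K => φ (g * (AutomorphyDatum.gl n K hcpt).ofK κ)) ∈ M)
    (ν : Measure (BlockIdx n k → AdeleRing (𝓞 K) K)) [IsFiniteMeasureOnCompacts ν]
    (y : (AdelicGroupData.gl n K).Adelic) :
    (fun κ : Kinf n K => blockCT (le_refl n) k ν φ (y * (AutomorphyDatum.gl n K hcpt).ofK κ)) ∈ M := by
  haveI := t2Space_adeleRing K
  haveI := secondCountableTopology_adeleRing K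
  haveI : BorelSpace (BlockIdx n k → AdeleRing (𝓞 K) K) := Pi.borelSpace
  -- the unipotents in box coordinates, as elements of `G(𝔸_K)`
  set u : (BlockIdx n k → AdeleRing (𝓞 K) K) → (AdelicGroupData.gl n K).Adelic := fun N =>
    unipotentOfBlock n k (AdeleRing (𝓞 K) K)
      (Multiplicative.ofAdd (blockMatrixEquiv (AdeleRing (𝓞 K) K) n k N)) with hu
  -- the slice of the constant term is the integral of the slices of `φ` at `(1 + N) y`
  set f : (BlockIdx n k → AdeleRing (𝓞 K) K) → Kinf n K → ℂ := fun N κ =>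
    φ (u N * (y * (AutomorphyDatum.gl n K hcpt).ofK κ)) with hf
  have heq : (fun κ : Kinf n K => blockCT (le_refl n) k ν φ (y * (AutomorphyDatum.gl n K hcpt).ofK κ)) =
      fun κ => ∫ N, f N κ ∂(ν.restrict (piFundamentalDomain K (BlockIdx n k))) := by
    funext κ
    rw [blockCT_apply]
    simp_rw [glCorner_refl]
    rfl
  rw [heq]
  refine Submodule.integral_mem_of_forall_mem _ M (f := f) (fun N => ?_) fun κ => ?_
  · have h1 : f N = fun κ => φ (u N * y * (AutomorphyDatum.gl n K hcpt).ofK κ) := by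
      funext κ
      simp only [hf, mul_assoc]
    rw [h1]
    exact hφM _
  · have h := hleft.integrableOn_blockCT (k := k) hφc ν (y * (AutomorphyDatum.gl n K hcpt).ofK κ)
    simp_rw [glCorner_refl] at h
    exact h

end Slices

/-! ### 3. Continuity -/

section Continuity

variable {k : ℕ}

omit [BorelSpace (AdeleRing (𝓞 K) K)] in
/-- **The constant term of a continuous function is continuous** (for any measure finite on
compact sets on the box): near `y₀` the integrand `φ ((1 + N) y)` is bounded uniformly for `N` in
the relatively compact box and `y` in a compact neighbourhood of `y₀` (`GL_n(𝔸_K)` is locally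
compact), so dominated convergence applies (`continuousAt_of_dominated`). Moeglin–Waldspurger
1995, I.2.6. [cite: MoeglinWaldspurger1995, I.2.6] -/
theorem continuous_blockCT [BorelSpace (AdeleRing (𝓞 K) K)] {φ : GL (Fin n) (AdeleRing (𝓞 K) K) → ℂ}
    (hφc : Continuous φ) (ν : Measure (BlockIdx n k → AdeleRing (𝓞 K) K))
    [IsFiniteMeasureOnCompacts ν] : Continuous (blockCT (le_refl n) k ν φ) := by
  haveI := t2Space_adeleRing K
  haveI := secondCountableTopology_adeleRing K
  haveI : BorelSpace (BlockIdx n k → AdeleRing (𝓞 K) K) := Pi.borelSpace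
  haveI : LocallyCompactSpace (GL (Fin n) (AdeleRing (𝓞 K) K)) :=
    AdelicGroupData.locallyCompactSpace_generalLinearGroup_adeleRing K (Fin n)
  haveI : SecondCountableTopology (GL (Fin n) (AdeleRing (𝓞 K) K)) :=
    secondCountableTopology_generalLinearGroup_adeleRing K (Fin n)
  set u : (BlockIdx n k → AdeleRing (𝓞 K) K) → GL (Fin n) (AdeleRing (𝓞 K) K) := fun N =>
    unipotentOfBlock n k (AdeleRing (𝓞 K) K)
      (Multiplicative.ofAdd (blockMatrixEquiv (AdeleRing (𝓞 K) K) n k N)) with hu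
  have huc : Continuous u :=
    continuous_unipotentOfBlock_ofAdd'.comp (continuous_blockMatrixEquiv n k)
  have hjc : Continuous fun p : (BlockIdx n k → AdeleRing (𝓞 K) K) × GL (Fin n) (AdeleRing (𝓞 K) K) =>
      φ (u p.1 * p.2) := hφc.comp ((huc.comp continuous_fst).mul continuous_snd)
  have hfin : ν (piFundamentalDomain K (BlockIdx n k)) < ⊤ :=
    (measure_mono subset_closure).trans_lt
      (isCompact_closure_piFundamentalDomain K (BlockIdx n k)).measure_lt_top
  haveI : IsFiniteMeasure (ν.restrict (piFundamentalDomain K (BlockIdx n k))) :=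
    ⟨by rwa [Measure.restrict_apply_univ]⟩
  have heq : blockCT (le_refl n) k ν φ = fun y => ∫ N, φ (u N * y)
      ∂(ν.restrict (piFundamentalDomain K (BlockIdx n k))) := by
    funext y
    rw [blockCT_apply]
    simp_rw [glCorner_refl]
    rfl
  rw [heq]
  refine continuous_iff_continuousAt.2 fun y₀ => ?_
  obtain ⟨C, hC, hCy⟩ := exists_compact_mem_nhds y₀
  -- a uniform bound on `closure D × C`
  obtain ⟨B, hB⟩ := ((isCompact_closure_piFundamentalDomain K (BlockIdx n k)).prod hC).exists_bound_of_continuousOn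
    hjc.continuousOn
  refine continuousAt_of_dominated (bound := fun _ => B) ?_ ?_ (integrable_const B) ?_
  · exact Eventually.of_forall fun y => (hφc.comp (huc.mul continuous_const)).aestronglyMeasurable
  · filter_upwards [hCy] with y hy
    rw [ae_restrict_iff' (measurableSet_piFundamentalDomain K (BlockIdx n k))]
    exact Eventually.of_forall fun N hN => hB (N, y) (mk_mem_prod (subset_closure hN) hy)
  · exact Eventually.of_forall fun N => (hφc.comp (continuous_const.mul continuous_id)).continuousAt

end Continuity

end Literature.NumberTheory.Automorphic
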